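import Mathlib
import HarnessLib
import HarnessLib.Audit
import Summits.Schanuel.Statement

/-!
Route: ExpGaussMap

CLOSED (retired) 2026-08-15T13:51:00Z by operator:999:1257524 — reason: not-a-thesis: assembly does not conclude the sub-problem Statement — note: D-0027 §2.1 audit (human 2026-08-15: routes that do not decide the summit are removed): the assembly concludes `AntiLagrange`, not the sub-problem statement; a NEW conforming route may be opened from the same idea (generated `closes : … → _root_.Schanuel`).. The file is kept as the record of this route; refuted decls are indexed as negative knowledge (`ledger negatives`).

# Route ExpGaussMap — Schanuel as the anti-Lagrange theorem of the continued logarithm y↦{eʸ} and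
the continued exponential y↦{−log y}, graded rung by rung

INSTANCE route, strictly below the summit (like StokesConstantPi / ModulusFirst: the target is
implied by Schanuel, support
BelowSummit + Assembly, and does not imply it). Realises card exp-gauss-map-anti-lagrange (with the
merged companion
critical-base-e-kneading). Objects: the two Rényi f-expansions generated by exp itself — the
CONTINUED LOGARITHM map
T y = {eʸ} = eʸ − ⌊eʸ⌋ (digits ⌊eʸ⌋ ∈ {1,2} on [0,1); x = log(d₁ + log(d₂ + ⋯))) and its dual, the
CONTINUED EXPONENTIAL map
S y = {−log y} (digits ∈ ℕ; x = e^−(d₁ + e^−(d₂ + ⋯)); Ω = W(1) = 0.567143… is its all-zero-digit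
fixed point). Periodic points of T and S
are exactly the real INTEGER-SHIFTED EXPONENTIAL CYCLES e^(y_i) = y_(i+1) + k_i, i.e. roots of
shifted towers. Lagrange: eventually
periodic continued fraction ⟺ quadratic; K. Schmidt: for Pisot β, eventually periodic β-expansion ⟺
x ∈ ℚ(β). X = ANTI-LAGRANGE ("it
suffices to show", for this instance family): NO nonzero real algebraic number has an eventually
periodic T-orbit, and no positive
algebraic x ≠ 1 has an eventually periodic S-orbit (finite expansions included: T 0 = 0 and, with
Lean's log 0 = 0, S-expansions that
terminate are eventually 0). X is a countable conjunction of Schanuel instances of a very special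
sparse shape (real, integer
shifts, cyclic), GRADED BY PATTERN (preperiod m, period p): m + p = 1 is Hermite–Lindemann (PROVED
in the tree, support PeriodOne);
m + p = 2 is exactly the first open rung of the subject in two faces — SecondOrderHL (e^(a + b·e^β)
∉ ℚ̄, containing e^e) and the
ℚ̄-linear E⊗log rung ExpLogLinearRung — and every pattern is one instance of the single load-bearing
crux RecursiveHermiteLindemann
("if every e^(z_i) lies in ℚ̄ + span_ℚ(z) then span_ℚ(z) ∩ ℚ̄ = 0"; n = 1 IS Hermite–Lindemann),
whose x = 1 instance is ENotLogParry
(the itinerary of e is aperiodic: e is not a 'log-Parry base').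
Lean: `(∀ x : ℝ, IsAlgebraic ℚ x → x ≠ 0 → ∀ m p : ℕ, 0 < p → (fun y : ℝ => Int.fract (Real.exp
y))^[m + p] x ≠ (fun y : ℝ => Int.fract (Real.exp y))^[m] x) ∧ (∀ x : ℝ, IsAlgebraic ℚ x → 0 < x → x
≠ 1 → ∀ m p : ℕ, 0 < p → (fun y : ℝ => Int.fract (-Real.log y))^[m + p] x ≠ (fun y : ℝ => Int.fract
(-Real.log y))^[m] x)`

## Assembly
Bookkeeping over Mathlib plus the tree's Hermite–Lindemann, staffable now. (T) Given real algebraic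
x ≠ 0 with T^(m+p) x = T^m x, the
orbit z_i = T^(i−1) x (i = 1 … m+p, as complex numbers) is exponentially recursive: e^(z_i) =
z_(i+1) + ⌊e^(z_i)⌋ and
e^(z_(m+p)) = z_(m+1) + ⌊e^(z_(m+p))⌋; RecursiveHermiteLindemann at c = e₁ gives x = 0,
contradiction. (S) Given real algebraic
x > 0, x ≠ 1 with S^(m+p) x = S^m x, take m minimal and let i₀ ≤ m+p+1 be the first index with
y_(i₀) = 0 if any (y_i = S^(i−1) x):
the tuple w_i = log y_i = −(k_i + y_(i+1)) (i < i₀, resp. i ≤ m+p) satisfies e^(w_1) = x ∈ ℚ̄ and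
e^(w_i) = y_i = −w_(i−1) − k_(i−1)
(i ≥ 2), so it is exponentially recursive; an algebraic nonzero element of its ℚ-span is supplied by
(finite case) w_(i₀−1) = −k_(i₀−1)
∈ ℤ, nonzero unless y_(i₀−1) = 1, i.e. i₀ = 2 and x = 1 (excluded); (purely periodic) w_p = −(k_p +
x); (preperiodic, m ≥ 1)
w_m − w_(m+p) = k_(m+p) − k_m ∈ ℤ, nonzero because w_m = w_(m+p) would give y_m = y_(m+p) and a
shorter preperiod.
RecursiveHermiteLindemann then gives the contradiction. ExpLogLinearRung, SecondOrderHL and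
ENotLogParry do not enter the
assembly: they are the named first open rungs / flagship instance of the target (ranks 3–5), kept as
items so that progress on
ANY mixed-depth engine is immediately legible as "Lagrange up to pattern length 2".

Rationale: WHY THIS LINE. Mechanism: a NUMERATION DEFINED BY exp (Rényi 1957 f-expansions with f = log and f =
e^(−t), Renyi1957; the only paper on the
dynamics, Neunhauserer2018 = arXiv:1808.01222, treats integer bases m ≥ 3 metrically and has no
arithmetic) turns the countable core
of Schanuel's conjecture into symbolic dynamics: periodic points = integer-shifted exp-cycles =
isolated zeros of square Khovanskii
systems (so in Kirby's ecl(∅), Kirby2010EAEF; under SC tower points are generic, Marker2006,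
DaquinoFornasieroTerzo2017), and the
conjecture reads "algebraic ⟹ aperiodic" — the exact inversion of Lagrange's theorem and of
Schmidt's Pisot theorem
(SchmidtPisot1980), with the period ↔ tower-depth grading landing on named open rungs (BakerTNT1975
p.111: only "e^e or e^(e²)";
Chudnovsky1984 p.307 Cor. 1.8/1.10). Imported: f-expansions and infinite ergodic theory (T is an AFN
map with the indifferent fixed
point 0, T y − y ~ y²/2: conservative ergodic INFINITE invariant measure, digit 2 of frequency zero
— Thaler1983, Zweimuller1998,
Zweimuller2000, Aaronson1997; S has full branches, |(S²)′| ≥ e and Rényi distortion: finite ergodic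
acim), which supply provable
theorems about how every real number sits relative to the shifted-cycle sector of the core, plus a
negative-side protocol of a new
shape (search algebraic x of small height × symbolic pattern; each hit refutes Schanuel). What it
does that the 13 open routes do
not: none has a real-dynamics / numeration object; the route files the self-referential
("exponentially recursive") corner of the
linear shadow of SC as ONE crux with Hermite–Lindemann as its n = 1 case, places e^e and the E⊗log
rung as its m + p = 2 patterns,
and gives refuters a certified pattern search; honest caveat (card + triage): numeration is soft —
no transcendence engine beyond
HL is claimed, every open item is as hard as its Khovanskii depth. Negatives index: empty (0 refuted
statements, 2026-08-15).

RANKED CRUXES. #0 AntiLagrange (target) — X — (T) for every real algebraic x ≠ 0 and all m, p > 0,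
T^(m+p) x ≠ T^m x where T y = {eʸ}; (S) for every real algebraic x > 0, x ≠ 1, and all m, p > 0,
S^(m+p) x ≠ S^m x where S y = {−log y} (card items S2/C1 generalised to all patterns; x = 1 of (T)
is ENotLogParry). (why it might fail: Implied by Schanuel (BelowSummit + Assembly), so false only
with SC: iff some algebraic x ≠ 0 of some height has an eventually periodic
continued-logarithm/ -exponential expansion — a sparse depth-(m+p) relation no PSLQ-type search has
ever probed.) [Renyi1957, Neunhauserer2018, SchmidtPisot1980, Waldschmidt2000]
#2 RecursiveHermiteLindemann (crux) — RECURSIVE HERMITE–LINDEMANN: if z₁,…,zₙ ∈ ℂ are such that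
every e^(z_i) lies in ℚ̄ + ℚz₁ + ⋯ + ℚzₙ ("exponentially recursive tuple": shifted exp-chains and
-cycles, periodic points of z ↦ e^z + k, fixed points of exp and their conjugates, T-orbits, the
log-coordinates of S-orbits), then the only algebraic number in span_ℚ(z) is 0. n = 1 is
Hermite–Lindemann; LinSC of card linear-schanuel-all-depths implies it; it is the one hypothesis of
the Assembly. [difficulty: open-problem] (why it might fail: n = 2 already contains e^e ∉ ℚ̄ and 'Re
z₀, Im z₀ ∉ ℚ̄ for fixed points z₀ = e^(z₀)'; exp∘exp has infinite order, outside every E- /Gevrey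
class, and no method treats self-referential tuples; false iff SC fails on an exponentially
recursive tuple.) [BakerTNT1975, DaquinoFornasieroTerzo2017, Marker2006, Kirby2010EAEF,
Chudnovsky1984]
#3 ExpLogLinearRung (crux) — the depth-one MIXED LINEAR RUNG over ℚ̄ (one exponential, one
logarithm): for algebraic α ≠ 0 and l ≠ 0 with e^l algebraic, 1, e^α, l are linearly independent
over ℚ̄ (c₀ + c₁e^α + c₂l = 0 with algebraic c's forces c₁ = c₂ = 0). The a = b = 1 case of L1 of
card linear-schanuel-all-depths = the linear rung of card tensor-mixed-gevrey-division (file once;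
shared). In this route it is the S-pattern (1,1) into a fixed point W(e^−k) (x·e^(k₁−k₂) + log x +
k₁ = 0) and, via LinearRungGivesSecondOrder, it implies SecondOrderHL. [difficulty: open-problem]
(why it might fail: Baker's method (logs) and Siegel–Shidlovskii (E-values) each prove one face but
their auxiliary constructions are Gevrey-incompatible at a finite algebraic point; open even as 'e√2
+ log 2 ∉ ℚ̄'; Chudnovsky's P1 (log α ⊥ α^β) is the nearest printed problem.) [BakerTNT1975,
Rivoal2024, Chudnovsky1984, Waldschmidt2004, FischlerRivoal2024]
#4 SecondOrderHL (crux) — HERMITE–LINDEMANN ONE STOREY UP: for algebraic β ≠ 0 and rational a, b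
with b ≠ 0, e^(a + b·e^β) is transcendental; equivalently (mod HL) 1, e^β, log γ are ℚ-LINEARLY
independent for all algebraic β ≠ 0, γ. Contains e^e, e^(1/e), e^(e^√2) ∉ ℚ̄. It is the common
content of the T-patterns (0,2) [e^(e^β − k₁) = β + k₂], (2,1) [log(k₁ + log k₂) ∉ ℚ̄] and the
S-patterns (0,2), (2,1) [e^(−k₁ − e^−k₂) ∉ ℚ̄]; implied by crux 2 (RecursiveGivesSecondOrder, proved
in the sketch) and by crux 3. [difficulty: open-problem] (why it might fail: It contains Schneider's
e^e problem: in print only 'e^e or e^(e²)' and 'e^(e^r) or e^(e^(2−r))' (Brownawell–Waldschmidt via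
Gel'fond's method, BakerTNT1975 p.111, Chudnovsky1984 Cor 1.8/1.10); exp∘exp is in no E- /G- /Gevrey
class (Rivoal2024 §4).) [BakerTNT1975, Chudnovsky1984, Rivoal2024, Waldschmidt2004]
#5 ENotLogParry (crux) — e IS NOT A LOG-PARRY BASE: the T-orbit of 1 (T 1 = e − 2 = 0.71828…, T² 1 =
e^(e−2) − 2 = 0.050906…, itinerary κ(e) = 2,2,1³⁸,2,1²,2,1⁸,2,1³,2,1¹³,…) is not eventually periodic
— the flagship single-orbit instance (x = 1 of the target; merged card critical-base-e-kneading
B2/B4: b = e is the critical base, T′(0) = 1), analogue of 'β is a Parry number iff the T_β-orbit of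
1 is finite'. [deps: RecursiveHermiteLindemann] [difficulty: open-problem] (why it might fail: Each
pattern (m,p) is ONE exponential-tower identity in e; patterns with m+p ≤ 120 fail numerically (min
|Tⁱ1 − Tʲ1| = 6.0e−4, planner scratch, uncertified) but no theorem excludes a long pattern; false
iff e−2 has an eventually periodic continued logarithm.) [BakerTNT1975, SchmidtPisot1980,
Neunhauserer2018, AdamczewskiBugeaud2007]
#9 BelowSummit (support) — every crux is a consequence of the summit: Schanuel →
RecursiveHermiteLindemann ∧ ExpLogLinearRung (predimension bookkeeping: for a ℚ-basis B of span(z),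
ℚ(B, e^B) is algebraic over ℚ(B), so trdeg ℚ(B) = |B| and no nonzero algebraic element lies in the
span; for the rung, (α, l) is ℚ-free by HL and trdeg ℚ(l, e^α) = 2). With RecursiveGivesSecondOrder
and the Assembly this certifies that no item of the route is refutable short of refuting Schanuel.
[difficulty: provable-now] [Waldschmidt2000, Kirby2010EAEF, Lang1966]
#9 LinearRungGivesSecondOrder (support) — ExpLogLinearRung → SecondOrderHL (if e^(a + b e^β) = γ ∈
ℚ̄ put l = a + b e^β ≠ 0 by HL (tree `transcendental_exp_holds`); then a + b·e^β − l = 0 is a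
ℚ̄-linear relation with c₁ = b ≠ 0). [difficulty: provable-now] [BakerTNT1975, Lindemann1882]
#9 RecursiveGivesSecondOrder (support) — RecursiveHermiteLindemann → SecondOrderHL (apply n = 2 to z
= (β, a + b e^β): e^β = −a/b + (1/b)z₂, e^(z₂) ∈ ℚ̄; conclusion at c = (1,0) gives β = 0). PROVED
sorry-free in the planner sketch (12 lines, axioms propext/Classical.choice/Quot.sound) — to be
re-proved in Theorems. [difficulty: provable-now] [BakerTNT1975, Hermite1873]
#9 PeriodOne (support) — PERIOD ONE IS HERMITE–LINDEMANN (tree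
`Literature.NumberTheory.Transcendental.transcendental_exp_holds`): for real algebraic x ≠ 0, T x ≠
x and T(T x) ≠ T x (T has no fixed point but 0 on [0,1) since eʸ − y = 1 only at y = 0; T x = 0
means eˣ ∈ ℤ); for real algebraic x > 0, x ≠ 1, S x ≠ x (the S-fixed points are W(e^−k),
transcendental) and S x ≠ 0 (x ≠ e^−k). [difficulty: provable-now] [Lindemann1882, Hermite1873,
BakerTNT1975]
#9 ItineraryInjective (support) — THE DIGITS DETERMINE THE POINT (so 'eventually periodic expansion'
= 'eventually periodic orbit'): two points of [0,1) with the same T-digit sequence ⌊e^(Tⁿx)⌋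
coincide (strict convexity: δ_(n+1) ≥ δ_n + δ_n²/2 while δ_n ≤ 1); two points of (0,1) whose
S-orbits avoid 0 and have the same S-digits ⌊−log Sⁿx⌋ coincide (|(S²)′| = 1/(y·Sy) ≥ e). The 'avoid
0' proviso is necessary: e^−1 and e^−(1+Ω) share the digits 1,0,0,…. [difficulty: provable-now]
[Renyi1957, Thaler1983, DajaniKalle2021]
#9 InfiniteMeasureT (support) — T IS BARELY INFINITE: T y = {eʸ} admits a σ-finite invariant measure
μ equivalent to Lebesgue on [0,1) with μ[0,1) = ∞, μ[ε,1) < ∞ for every ε > 0, conservative and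
ergodic (T is an AFN map: Adler distortion T″/T′² = e^−y ≤ 1, finite image partition {[0,1),
[0,e−2)}, one indifferent fixed point 0 with T y − y ~ y²/2; density ~ c/y; Zweimüller's
non-Markovian extension of Thaler's theorem). Consequence for later: digit 2 has frequency 0 a.e.
(return sequence ≍ n/log n). [difficulty: XL] [Zweimuller1998, Zweimuller2000, Thaler1983,
Aaronson1997]
#9 FiniteMeasureS (support) — S y = {−log y} admits an ergodic invariant probability measure
equivalent to Lebesgue on [0,1) (full branches (e^−(k+1), e^−k] → [0,1), S² uniformly expanding with
|(S²)′| ≥ e, Rényi's bounded-distortion condition Σ|t_i − s_i| < ∞; density between 1/C and C) — the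
Gauss–Kuzmin theory of the continued exponential; its Khinchin/Lévy-type constants are new
computable numbers. [difficulty: L] [Renyi1957, DajaniKalle2021, Aaronson1997]

TWO-LAYER PLAN. Foreseen glued splits (k ≤ 3, depth 1), filed only when something lands: (i)
AntiLagrange ⇐ PatternsUpToTwo → PatternsBeyondTwo →
AntiLagrange, where PatternsUpToTwo (m + p ≤ 2, both maps) follows from PeriodOne + SecondOrderHL +
RecursiveHermiteLindemann at
n = 2 and is the natural first deliverable once SecondOrderHL moves; (ii) RecursiveHermiteLindemann
⇐ (n ≤ 2) → (n ≥ 3) with the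
n ≤ 2 child split further by the shape of the coefficient matrix (triangular = towers; cyclic =
2-cycles of z ↦ e^z + k; conjugate
pairs of Fix(exp)); (iii) ENotLogParry ⇐ (certified exclusion of all patterns with m + p ≤ N₀, a kit
interval computation filed as
`kind: computation` evidence) → (patterns beyond N₀) → ENotLogParry. The complex extension
(eventually periodic INTEGER-SHIFTED
CHAINS in ℂ: the only algebraic entry is 0) is RecursiveHermiteLindemann's cyclic case and needs no
new item.

KILL CRITERIA. A certified algebraic x ≠ 0 (any height) with an eventually periodic T- or
S-expansion refutes AntiLagrange, RecursiveHermiteLindemann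
AND Schanuel at once (every Schanuel route closes; this route closes `refuted:AntiLagrange` having
done its job as a refutation
channel). A refutation of ExpLogLinearRung alone (a ℚ̄-relation c₀ + c₁e^α + c₂ log γ = 0 with
irrational algebraic coefficients)
also refutes Schanuel but NOT the target: pivot = drop crux 3, keep the ℚ-linear ladder.
ENotLogParry refuted (e−2 eventually
periodic) ⇒ ¬AntiLagrange at x = 1 ⇒ as above. If RecursiveHermiteLindemann is shown EQUIVALENT to
Schanuel (unlikely: it is
implied by the linear shadow LinSC) the route is a restatement ⇒ close `superseded` in favour of
whichever route holds LinSC. If a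
LinSC route opens (card linear-schanuel-all-depths) crux 3 should be shared with it (same statement
filed once) and this route keeps
only the recursive/dynamical items.

NOT DECOMPOSED YET. The metric/shrinking-target statements of the card (C2: Hausdorff dimension of
points whose orbits return near a period-p pattern
infinitely often; 'algebraic x are not abnormally close to shifted towers' via LW/Baker measures at
m + p ≤ 2) — they need the two
measure items first and transcendence MEASURES for tower points that do not exist beyond depth 1
(card
baker-for-exponential-algebraic-numbers); digit-frequency laws (Darling–Kac index 1 for T,
Gauss–Kuzmin for S) as corollaries of
InfiniteMeasureT / FiniteMeasureS; the dynamical zeta function / prime-orbit counting of T (h_top =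
log λ_e, λ_e = 1.61803399…,
length of a cycle = Σ y_i) and the base family b ↦ {bʸ} (log-Parry bases are exp-algebraic; SC ⇒ no
algebraic non-integer base is
log-Parry) from the merged card; the certified pattern search itself (a kit job, evidence not an
item); full SC for exponentially
recursive tuples (trdeg = dim span), deliberately NOT filed — only its linear shadow (crux 2) is.

CHEAPEST FALSIFIER. Certified pattern search (one kit job, interval arithmetic, minutes): all
algebraic x ∈ (0,1) of degree ≤ 4 and height ≤ 200, plus
x = 1, T- and S-orbits to 60 digits, flag |T^(m+p) x − T^m x| < 10⁻⁴⁰ with m + p ≤ 40; any certified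
hit kills the target and
Schanuel. Planner's uncertified run (scratch/numerics.py, decimal 150 digits): 99 small algebraic
candidates (rationals q ≤ 12,
(a+√d)/c, ∛d + a, 1), 40 steps, both maps: 0 near-coincidences below 10⁻⁶⁰; orbit of 1: min |Tⁱ1 −
Tʲ1| over 0 ≤ i < j ≤ 120 is
6.0·10⁻⁴ (at (27,76)). Lookup falsifier for novelty: a printed 'transcendence of periodic continued
logarithms' or an m^x-mod-1 paper
with arithmetic content (searched: only Neunhauserer2018, metric, integer bases).

NUMBERS. T 1 = e − 2 = 0.718281828…; T² 1 = e^(e−2) − 2 = 0.050906372… (so the pattern (2,1)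
'e^(e−2) = 2' fails by 0.0509); κ(e) run-lengths
2,2,1³⁸,2,1²,2,1⁸,2,1³,2,1¹³ (70 digits; reproduces the card); admissible T-cycles of length ≤ 3:
(1,2) with y* = 0.68742200969238841531…,
u* = e^(y*) − 1 = log(2 + y*) = 0.98858237338335916993…, and (1,1,2) with 0.50115900068516116963…;
words (1,2,2), (2,2,·) are not
admissible (after a digit 2 the next 2 needs T y ∈ [log 2, e−2) = [0.6931, 0.7183)). S fixed points:
Ω = W(1) = 0.56714329040978387299…
(digit 0), W(e⁻¹) = 0.27846454276107379510… (digit 1), 0.12002823898764122948… (digit 2),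
0.04747849102486547567… (digit 3) — all
transcendental by HL. Digit-2 counts along T-orbits to n = 600: #₂·log n/n = 0.61 (x = 1), 0.16 (√2
− 1), 0.35 (1/2), consistent with
frequency zero. Known unconditionally: m + p = 1 (HL); 'e^e or e^(e²)', 'e^(e^r) or e^(e^(2−r))' (r
∈ ℚ) transcendental
(BakerTNT1975 p.111, Chudnovsky1984 p.307). Items at open: 13 (1 target, 4 cruxes, 7 support, 1
assembly).

DEFINITION REQUESTS. None. T and S are written inline (`fun y => Int.fract (Real.exp y)`, `fun y =>
Int.fract (-Real.log y)`; Lean's `Real.log 0 = 0`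
makes S 0 = 0 absorbing, which encodes finite continued exponentials as eventually-zero orbits);
Hermite–Lindemann and
Lindemann–Weierstrass are PROVED in the tree
(`Literature.NumberTheory.Transcendental.transcendental_exp_holds`,
`…LindemannWeierstrass.AlgIndep_holds`), so no cite facts are needed. If a grounder prefers named
maps, the notion would be
`contLogMap` / `contExpMap` under Summits/Schanuel/Schanuel/Theorems (not requested now).

Novelty: Searches (2026-08-15): `lit search --source zbmath "continued logarithm representation"` (15 rows:
Neunhauserer2018 =
doi:10.14321/realanalexch.43.1.0057 = arXiv:1808.01222 the only dynamics paper, integer bases m ≥ 3,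
metric; the Gosper/Brabec
'continued logarithm algorithm' is a different object); `lit search --source zbmath "periodic beta
expansions Pisot numbers"` (10:
SchmidtPisot1980 = doi:10.1112/blms/12.4.269, AdamczewskiBugeaud2007, Flatto–Lagarias–Poonen zeta of
T_β) for the Lagrange/Parry
analogy; `lit search --source zbmath "iterated exponentials generic solutions Schanuel conjecture"`
(1: DaquinoFornasieroTerzo2017 =
doi:10.1090/tran/7206); `lit search --hybrid` on 'e^e / e^(e²) transcendence' (BakerTNT1975 p.111
READ: Thm 12.2 and 'one at least of
e^e and e^(e²)'; Chudnovsky1984 pp.306–308 READ: Cor 1.8, 1.10) and on 'e + log 2 / linear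
independence of 1, e^α, log β' (no
result beyond Baker/LW faces); `lit search --source crossref` for Renyi1957
(doi:10.1007/bf02020331), Thaler1983
(doi:10.1007/bf02760623), Zweimuller1998 (doi:10.1088/0951-7715/11/5/005), Zweimuller2000
(doi:10.1017/s0143385700000821);
`lit galaxy search "continued exponential" --star all` (32 rows, all 'continued exponential growth'
noise); `lit frontier Schanuel
--since 2020` (21 rows: unlikely intersections, E- /zeta-values, quasi-elliptic Schanuel — nothing
dynamical); `lit bridges Schanuel
--cross any` (30, none on numeration); the card's own searches (galaxy 'continued logarithm' 16
rows, z  [refs: 10.14321/realanalexch.43.1.0057, 10.1112/blms/12.4.269, 10.1090/tran/7206, 10.1007/bf02020331, 10.1007/bf02760623, 10.1088/0951-7715/11/5/005, 10.1017/s0143385700000821, 1808.01222, doi:10.14321/realanalexch.43.1.0057, doi:10.1112/blms/12.4.269, doi:10.1090/tran/7206, doi:10.1007/bf02020331, doi:10.1007/bf02760623, doi:10.1088/0951-7715/11/5/005, doi:10.1017/s0143385700000821, Neunhauserer2018, Sc]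

Barriers (technique_class: f-expansions exp-recursive-tuples instance-ladder): - technique_class: f-expansions exp-recursive-tuples instance-ladder
- Literature.Barriers.Schanuel.AxSchanuelFunctionalNotNumerical: respected, not evaded — Ax/Kirby
enter only to say that shifted cycles are isolated Khovanskii points (in ecl ∅) and that SC makes
tower points generic; no numerical statement is drawn from functional transcendence; the route's
unconditional content is HL (n = 1) plus bookkeeping, and its open items are flagged as exactly as
hard as their depth.
- Literature.Barriers.Schanuel.AxiomsDoNotForceSchanuel: consistent — Bays–Kirby fields show
instance families cannot be derived softly; the dynamics here supplies METRIC theorems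
(InfiniteMeasureT, FiniteMeasureS, digit laws) and an organisation of instances, never a derivation
of an instance from axioms; the bet is only that the organisation makes partial progress legible and
refutation cheap.
- Literature.Barriers.Schanuel.SchanuelPropertyNotFirstOrder: n/a — all items are about the standard
reals/complexes, no transfer.
- Literature.Barriers.Schanuel.EFunctionValuesAtAlgebraicPoints: engaged honestly — SecondOrderHL
(e^e) and ExpLogLinearRung (e^α with log γ) are precisely the numbers Rivoal2024 §5 lists as
believed non-E-values; the route does not claim Siegel–Shidlovskii reaches them; it does not evade
the barrier, the bet is that whichever mixed engine (cards tensor-mixed-gevrey-division,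
shift-difference-periods) first crosses it is scored here as 'Lagrange up to length 2'.
- Literature.Barriers

Novelty grade: new-combination — ROUTE REVIEW (refuter rreview 935e0e2b, 2026-08-15T14Z). STRUCTURE: self-declared INSTANCE route strictly below the summit — support BelowSummit proves Schanuel ⟹ every crux and the Assembly concludes AntiLagrange, NOT the sub-problem statement. Under the human ruling D-0027 §2.1 (applied 13:48Z to  (refuter refuter-rreview-route-SmoothPoincare4-Le-935e0e2b-0, 2026-08-15T14:04:04Z; prior: arXiv:1808.01222,doi:10.1007/bf02020331,doi:10.1112/blms/12.4.269,doi:10.1090/tran/7206,BakerTNT1975,Chudnovsky1984)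

History (route lifecycle, newest last):
- 2026-08-15T13:51:00Z · CLOSED retired — not-a-thesis: assembly does not conclude the sub-problem Statement (operator:999:1257524)

sub-problem: Schanuel · status: closed(retired) · opened planner-plancard-Schanuel-Schanuel-exp-gauss--8e5a92ae-0 2026-08-15T12:12:43Z · rev 0 · ledger route-Schanuel-ExpGaussMap
GENERATED by the gate from the ledger (D-0016/17). Provers cite these decls: `theorem foo : Summit.Schanuel.Schanuel.Theses.ExpGaussMap.<Decl> := …` in Summits/Schanuel/Schanuel/Theorems/<Name>.lean.
-/

namespace Summit.Schanuel.Schanuel.Theses.ExpGaussMap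

open scoped BigOperators Topology Manifold Classical MeasureTheory ProbabilityTheory Matrix InnerProductSpace ComplexConjugate ContinuousMap
open Filter Set Function TopologicalSpace MeasureTheory

attribute [summit_statement] _root_.Schanuel

open Literature.Periods

/-- item stmt-Schanuel-7598 · target · rank 0 · closed · moot by None · by planner
why it might fail: Implied by Schanuel (BelowSummit + Assembly), so false only with SC: iff some algebraic x ≠ 0 of some height has an eventually periodic continued-logarithm/ -exponential expansion — a sparse depth-(m+p) relation no PSLQ-type search has ever probed.
sources: Renyi1957, Neunhauserer2018, SchmidtPisot1980, Waldschmidt2000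
[target] X — (T) for every real algebraic x ≠ 0 and all m, p > 0, T^(m+p) x ≠ T^m x where T y =
{eʸ}; (S) for every real algebraic x > 0, x ≠ 1, and all m, p > 0, S^(m+p) x ≠ S^m x where S y =
{−log y} (card items S2/C1 generalised to all patterns; x = 1 of (T) is ENotLogParry). -/
@[route_item "route-Schanuel-ExpGaussMap"]
def AntiLagrange : Prop :=
  (∀ x : ℝ, IsAlgebraic ℚ x → x ≠ 0 → ∀ m p : ℕ, 0 < p → (fun y : ℝ => Int.fract (Real.exp y))^[m + p] x ≠ (fun y : ℝ => Int.fract (Real.exp y))^[m] x) ∧ (∀ x : ℝ, IsAlgebraic ℚ x → 0 < x → x ≠ 1 → ∀ m p : ℕ, 0 < p → (fun y : ℝ => Int.fract (-Real.log y))^[m + p] x ≠ (fun y : ℝ => Int.fract (-Real.log y))^[m] x)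

/-- item stmt-Schanuel-7599 · crux · rank 2 · closed · moot by None · by planner
why it might fail: n = 2 already contains e^e ∉ ℚ̄ and 'Re z₀, Im z₀ ∉ ℚ̄ for fixed points z₀ = e^(z₀)'; exp∘exp has infinite order, outside every E- /Gevrey class, and no method treats self-referential tuples; false iff SC fails on an exponentially recursive tuple.
sources: BakerTNT1975, DaquinoFornasieroTerzo2017, Marker2006, Kirby2010EAEF, Chudnovsky1984
[crux] RECURSIVE HERMITE–LINDEMANN: if z₁,…,zₙ ∈ ℂ are such that every e^(z_i) lies in ℚ̄ + ℚz₁ + ⋯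
+ ℚzₙ ("exponentially recursive tuple": shifted exp-chains and -cycles, periodic points of z ↦ e^z +
k, fixed points of exp and their conjugates, T-orbits, the log-coordinates of S-orbits), then the
only algebraic number in span_ℚ(z) is 0. n = 1 is Hermite–Lindemann; LinSC of card
linear-schanuel-all-depths implies it; it is the one hypothesis of the Assembly. [difficulty:
open-problem] -/
@[route_item "route-Schanuel-ExpGaussMap"]
def RecursiveHermiteLindemann : Prop :=
  ∀ (n : ℕ) (z : Fin n → ℂ), (∀ i, ∃ (a : ℂ) (c : Fin n → ℚ), IsAlgebraic ℚ a ∧ Complex.exp (z i) = a + ∑ j, (c j : ℂ) * z j) → ∀ c : Fin n → ℚ, IsAlgebraic ℚ (∑ j, (c j : ℂ) * z j) → ∑ j, (c j : ℂ) * z j = 0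

/-- item stmt-Schanuel-7600 · crux · rank 3 · closed · moot by None · by planner
why it might fail: Baker's method (logs) and Siegel–Shidlovskii (E-values) each prove one face but their auxiliary constructions are Gevrey-incompatible at a finite algebraic point; open even as 'e√2 + log 2 ∉ ℚ̄'; Chudnovsky's P1 (log α ⊥ α^β) is the nearest printed problem.
sources: BakerTNT1975, Rivoal2024, Chudnovsky1984, Waldschmidt2004, FischlerRivoal2024
[crux] the depth-one MIXED LINEAR RUNG over ℚ̄ (one exponential, one logarithm): for algebraic α ≠ 0
and l ≠ 0 with e^l algebraic, 1, e^α, l are linearly independent over ℚ̄ (c₀ + c₁e^α + c₂l = 0 with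
algebraic c's forces c₁ = c₂ = 0). The a = b = 1 case of L1 of card linear-schanuel-all-depths = the
linear rung of card tensor-mixed-gevrey-division (file once; shared). In this route it is the
S-pattern (1,1) into a fixed point W(e^−k) (x·e^(k₁−k₂) + log x + k₁ = 0) and, via
LinearRungGivesSecondOrder, it implies SecondOrderHL. [difficulty: open-problem] -/
@[route_item "route-Schanuel-ExpGaussMap"]
def ExpLogLinearRung : Prop :=
  ∀ α l : ℂ, IsAlgebraic ℚ α → α ≠ 0 → IsAlgebraic ℚ (Complex.exp l) → l ≠ 0 → ∀ c₀ c₁ c₂ : ℂ, IsAlgebraic ℚ c₀ → IsAlgebraic ℚ c₁ → IsAlgebraic ℚ c₂ → c₀ + c₁ * Complex.exp α + c₂ * l = 0 → c₁ = 0 ∧ c₂ = 0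

/-- item stmt-Schanuel-7601 · crux · rank 4 · closed · moot by None · by planner
why it might fail: It contains Schneider's e^e problem: in print only 'e^e or e^(e²)' and 'e^(e^r) or e^(e^(2−r))' (Brownawell–Waldschmidt via Gel'fond's method, BakerTNT1975 p.111, Chudnovsky1984 Cor 1.8/1.10); exp∘exp is in no E- /G- /Gevrey class (Rivoal2024 §4).
sources: BakerTNT1975, Chudnovsky1984, Rivoal2024, Waldschmidt2004
[crux] HERMITE–LINDEMANN ONE STOREY UP: for algebraic β ≠ 0 and rational a, b with b ≠ 0, e^(a +
b·e^β) is transcendental; equivalently (mod HL) 1, e^β, log γ are ℚ-LINEARLY independent for all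
algebraic β ≠ 0, γ. Contains e^e, e^(1/e), e^(e^√2) ∉ ℚ̄. It is the common content of the T-patterns
(0,2) [e^(e^β − k₁) = β + k₂], (2,1) [log(k₁ + log k₂) ∉ ℚ̄] and the S-patterns (0,2), (2,1) [e^(−k₁
− e^−k₂) ∉ ℚ̄]; implied by crux 2 (RecursiveGivesSecondOrder, proved in the sketch) and by crux 3.
[difficulty: open-problem] -/
@[route_item "route-Schanuel-ExpGaussMap"]
def SecondOrderHL : Prop :=
  ∀ β : ℂ, IsAlgebraic ℚ β → β ≠ 0 → ∀ a b : ℚ, b ≠ 0 → Transcendental ℚ (Complex.exp ((a : ℂ) + (b : ℂ) * Complex.exp β))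

/-- item stmt-Schanuel-7602 · crux · rank 5 · closed · moot by None · by planner
why it might fail: Each pattern (m,p) is ONE exponential-tower identity in e; patterns with m+p ≤ 120 fail numerically (min |Tⁱ1 − Tʲ1| = 6.0e−4, planner scratch, uncertified) but no theorem excludes a long pattern; false iff e−2 has an eventually periodic continued logarithm.
sources: BakerTNT1975, SchmidtPisot1980, Neunhauserer2018, AdamczewskiBugeaud2007
[crux] e IS NOT A LOG-PARRY BASE: the T-orbit of 1 (T 1 = e − 2 = 0.71828…, T² 1 = e^(e−2) − 2 =
0.050906…, itinerary κ(e) = 2,2,1³⁸,2,1²,2,1⁸,2,1³,2,1¹³,…) is not eventually periodic — the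
flagship single-orbit instance (x = 1 of the target; merged card critical-base-e-kneading B2/B4: b =
e is the critical base, T′(0) = 1), analogue of 'β is a Parry number iff the T_β-orbit of 1 is
finite'. [deps: RecursiveHermiteLindemann] [difficulty: open-problem] -/
@[route_item "route-Schanuel-ExpGaussMap"]
def ENotLogParry : Prop :=
  ∀ m p : ℕ, 0 < p → (fun y : ℝ => Int.fract (Real.exp y))^[m + p] 1 ≠ (fun y : ℝ => Int.fract (Real.exp y))^[m] 1

/-- item stmt-Schanuel-7603 · support · rank 9 · closed · moot by None · by planner
sources: Waldschmidt2000, Kirby2010EAEF, Lang1966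
[support] every crux is a consequence of the summit: Schanuel → RecursiveHermiteLindemann ∧
ExpLogLinearRung (predimension bookkeeping: for a ℚ-basis B of span(z), ℚ(B, e^B) is algebraic over
ℚ(B), so trdeg ℚ(B) = |B| and no nonzero algebraic element lies in the span; for the rung, (α, l) is
ℚ-free by HL and trdeg ℚ(l, e^α) = 2). With RecursiveGivesSecondOrder and the Assembly this
certifies that no item of the route is refutable short of refuting Schanuel. [difficulty:
provable-now] -/
@[route_item "route-Schanuel-ExpGaussMap"]
def BelowSummit : Prop :=
  Schanuel → RecursiveHermiteLindemann ∧ ExpLogLinearRung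

/-- item stmt-Schanuel-7604 · support · rank 9 · closed · moot by None · by planner
sources: BakerTNT1975, Lindemann1882
[support] ExpLogLinearRung → SecondOrderHL (if e^(a + b e^β) = γ ∈ ℚ̄ put l = a + b e^β ≠ 0 by HL
(tree `transcendental_exp_holds`); then a + b·e^β − l = 0 is a ℚ̄-linear relation with c₁ = b ≠ 0).
[difficulty: provable-now] -/
@[route_item "route-Schanuel-ExpGaussMap"]
def LinearRungGivesSecondOrder : Prop :=
  ExpLogLinearRung → SecondOrderHL

/-- item stmt-Schanuel-7605 · support · rank 9 · closed · moot by None · by planner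
sources: BakerTNT1975, Hermite1873
[support] RecursiveHermiteLindemann → SecondOrderHL (apply n = 2 to z = (β, a + b e^β): e^β = −a/b +
(1/b)z₂, e^(z₂) ∈ ℚ̄; conclusion at c = (1,0) gives β = 0). PROVED sorry-free in the planner sketch
(12 lines, axioms propext/Classical.choice/Quot.sound) — to be re-proved in Theorems. [difficulty:
provable-now] -/
@[route_item "route-Schanuel-ExpGaussMap"]
def RecursiveGivesSecondOrder : Prop :=
  RecursiveHermiteLindemann → SecondOrderHL

/-- item stmt-Schanuel-7606 · support · rank 9 · closed · moot by None · by planner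
sources: Lindemann1882, Hermite1873, BakerTNT1975
[support] PERIOD ONE IS HERMITE–LINDEMANN (tree
`Literature.NumberTheory.Transcendental.transcendental_exp_holds`): for real algebraic x ≠ 0, T x ≠
x and T(T x) ≠ T x (T has no fixed point but 0 on [0,1) since eʸ − y = 1 only at y = 0; T x = 0
means eˣ ∈ ℤ); for real algebraic x > 0, x ≠ 1, S x ≠ x (the S-fixed points are W(e^−k),
transcendental) and S x ≠ 0 (x ≠ e^−k). [difficulty: provable-now] -/
@[route_item "route-Schanuel-ExpGaussMap"]
def PeriodOne : Prop :=
  (∀ x : ℝ, IsAlgebraic ℚ x → x ≠ 0 → Int.fract (Real.exp x) ≠ x ∧ Int.fract (Real.exp (Int.fract (Real.exp x))) ≠ Int.fract (Real.exp x)) ∧ (∀ x : ℝ, IsAlgebraic ℚ x → 0 < x → x ≠ 1 → Int.fract (-Real.log x) ≠ x ∧ Int.fract (-Real.log x) ≠ 0)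

/-- item stmt-Schanuel-7607 · support · rank 9 · closed · moot by None · by planner
sources: Renyi1957, Thaler1983, DajaniKalle2021
[support] THE DIGITS DETERMINE THE POINT (so 'eventually periodic expansion' = 'eventually periodic
orbit'): two points of [0,1) with the same T-digit sequence ⌊e^(Tⁿx)⌋ coincide (strict convexity:
δ_(n+1) ≥ δ_n + δ_n²/2 while δ_n ≤ 1); two points of (0,1) whose S-orbits avoid 0 and have the same
S-digits ⌊−log Sⁿx⌋ coincide (|(S²)′| = 1/(y·Sy) ≥ e). The 'avoid 0' proviso is necessary: e^−1 and
e^−(1+Ω) share the digits 1,0,0,…. [difficulty: provable-now] -/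
@[route_item "route-Schanuel-ExpGaussMap"]
def ItineraryInjective : Prop :=
  (∀ x y : ℝ, x ∈ Set.Ico (0 : ℝ) 1 → y ∈ Set.Ico (0 : ℝ) 1 → (∀ n : ℕ, ⌊Real.exp ((fun t : ℝ => Int.fract (Real.exp t))^[n] x)⌋ = ⌊Real.exp ((fun t : ℝ => Int.fract (Real.exp t))^[n] y)⌋) → x = y) ∧ (∀ x y : ℝ, x ∈ Set.Ioo (0 : ℝ) 1 → y ∈ Set.Ioo (0 : ℝ) 1 → (∀ n : ℕ, (fun t : ℝ => Int.fract (-Real.log t))^[n] x ≠ 0 ∧ (fun t : ℝ => Int.fract (-Real.log t))^[n] y ≠ 0) → (∀ n : ℕ, ⌊-Real.log ((fun t : ℝ => Int.fract (-Real.log t))^[n] x)⌋ = ⌊-Real.log ((fun t : ℝ => Int.fract (-Real.log t))^[n] y)⌋) → x = y)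

/-- item stmt-Schanuel-7608 · support · rank 9 · closed · moot by None · by planner
sources: Zweimuller1998, Zweimuller2000, Thaler1983, Aaronson1997
[support] T IS BARELY INFINITE: T y = {eʸ} admits a σ-finite invariant measure μ equivalent to
Lebesgue on [0,1) with μ[0,1) = ∞, μ[ε,1) < ∞ for every ε > 0, conservative and ergodic (T is an AFN
map: Adler distortion T″/T′² = e^−y ≤ 1, finite image partition {[0,1), [0,e−2)}, one indifferent
fixed point 0 with T y − y ~ y²/2; density ~ c/y; Zweimüller's non-Markovian extension of Thaler's
theorem). Consequence for later: digit 2 has frequency 0 a.e. (return sequence ≍ n/log n).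
[difficulty: XL] -/
@[route_item "route-Schanuel-ExpGaussMap"]
def InfiniteMeasureT : Prop :=
  ∃ μ : Measure ℝ, μ ≪ volume.restrict (Set.Ico (0 : ℝ) 1) ∧ volume.restrict (Set.Ico (0 : ℝ) 1) ≪ μ ∧ μ (Set.Ico (0 : ℝ) 1) = ⊤ ∧ (∀ ε : ℝ, 0 < ε → μ (Set.Ici ε) < ⊤) ∧ Ergodic (fun y : ℝ => Int.fract (Real.exp y)) μ ∧ Conservative (fun y : ℝ => Int.fract (Real.exp y)) μ

/-- item stmt-Schanuel-7609 · support · rank 9 · closed · moot by None · by planner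
sources: Renyi1957, DajaniKalle2021, Aaronson1997
[support] S y = {−log y} admits an ergodic invariant probability measure equivalent to Lebesgue on
[0,1) (full branches (e^−(k+1), e^−k] → [0,1), S² uniformly expanding with |(S²)′| ≥ e, Rényi's
bounded-distortion condition Σ|t_i − s_i| < ∞; density between 1/C and C) — the Gauss–Kuzmin theory
of the continued exponential; its Khinchin/Lévy-type constants are new computable numbers.
[difficulty: L] -/
@[route_item "route-Schanuel-ExpGaussMap"]
def FiniteMeasureS : Prop :=
  ∃ μ : Measure ℝ, IsProbabilityMeasure μ ∧ μ ≪ volume.restrict (Set.Ico (0 : ℝ) 1) ∧ volume.restrict (Set.Ico (0 : ℝ) 1) ≪ μ ∧ Ergodic (fun y : ℝ => Int.fract (-Real.log y)) μ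

/-- item stmt-Schanuel-7610 · assembly · rank 1 · closed · moot by None · by planner
sources: Renyi1957, Kirby2010EAEF, BakerTNT1975
[assembly] RecursiveHermiteLindemann → AntiLagrange (orbits of T, and log-coordinates of orbits of
S, are exponentially recursive tuples whose ℚ-span contains a nonzero algebraic number). -/
@[route_item "route-Schanuel-ExpGaussMap"]
def Assembly : Prop :=
  RecursiveHermiteLindemann → AntiLagrange

end Summit.Schanuel.Schanuel.Theses.ExpGaussMap
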